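import Mathlib.Analysis.LocallyConvex.WithSeminorms
import Mathlib.Topology.Metrizable.Basic
import Literature.Analysis.FunctionSpaces.NuclearSpace
import HarnessLib

/-!
# Nuclearly dominated seminorms: permanence properties and separability

Support file for the nuclearity and separability of the Schwartz space (the named facts
`Literature.Analysis.FunctionSpaces.nuclearSpace_schwartzMap`, `Literature.Analysis.FunctionSpaces.separableSpace_schwartzMap` of
`Literature/Analysis/FunctionSpaces/NuclearSpace.lean`, consumed by Minlos' theorem for `𝒮'`).

`Literature.NuclearSpace 𝕜 E` (Pietsch's intrinsic form of nuclearity, Pietsch 1972, Prop. 4.1.4) asks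
that every continuous seminorm `p` be *nuclearly dominated*: `p x ≤ ∑ₙ ‖φₙ x‖` for continuous
linear functionals `φₙ` with `‖φₙ x‖ ≤ cₙ q x`, `∑ cₙ < ∞`, `q` a continuous seminorm. This file
isolates that condition as a predicate `Literature.IsNuclearlyDominated p` and proves the elementary
closure properties that reduce nuclearity of a space to nuclear domination of a *generating*
family of seminorms and transport it along continuous linear retractions:

* `IsNuclearlyDominated.of_countable` (any countable index set may be used), `mono`, `smul`,
  `add`, `finset_sum`, `finset_sup`, `comp` (pull-back along a continuous linear map);
* `IsNuclearlyDominated.nuclearSpace_of_withSeminorms`: if the topology of `E` is generated by a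
  family of seminorms each of which is nuclearly dominated, then `E` is nuclear
  (continuous seminorms are bounded by finite suprema of the family,
  `Seminorm.bound_of_continuous`);
* `NuclearSpace.of_finite_retracts`, `NuclearSpace.of_retract`,
  `NuclearSpace.of_continuousLinearEquiv`: if `x = ∑ᵢ Sᵢ (Tᵢ x)` with `Tᵢ : E →L F`,
  `Sᵢ : F →L E` and `F` nuclear, then `E` is nuclear (Pietsch 1972, §5.1–5.2: subspaces,
  quotients by complemented subspaces, isomorphic images);
* `IsNuclearlyDominated.exists_countable_dense`: a nuclearly dominated seminorm `p` is
  separable (there is a countable set `S` with `inf_{s ∈ S} p (x - s) = 0` for every `x`), and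
  hence `NuclearSpace.separableSpace_of_withSeminorms`: a nuclear space whose topology is
  generated by countably many seminorms (e.g. a nuclear Fréchet space) is separable
  (Pietsch 1972, Prop. 4.4.9 and Thm. 4.4.10).

## Proof of separability

If `p x ≤ ∑ₙ ‖φₙ x‖`, `‖φₙ x‖ ≤ cₙ q x`, then for `q x ≤ k` and `M` with `(∑_{n ≥ M} cₙ)(2k+1)`
small, `p (x - s) ≤ ∑_{n < M} ‖φₙ x - φₙ s‖ + (∑_{n ≥ M} cₙ)(q x + q s)`; so it suffices to take for
`S` preimages in `{q ≤ k}` of a countable dense subset of the image of `{q ≤ k}` under the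
finite-dimensional map `x ↦ (φₙ x)_{n < M} ∈ 𝕜^M` (every subset of `𝕜^M` is separable), over all
`M, k ∈ ℕ`.

## References

* A. Pietsch, *Nuclear locally convex spaces*, Ergebnisse 66, Springer (1972), Prop. 4.1.4
  (seminorm form of nuclearity, property (Q): `p_U(x) ≤ ∑ₙ |⟨x, aₙ⟩|`, `∑ₙ p_{V°}(aₙ) < ∞`, for
  some resp. each fundamental system of zero neighbourhoods), Prop. 4.4.9 (the normed spaces
  `E(U)` of a nuclear space are separable), Thm. 4.4.10 (nuclear metric locally convex spaces are
  separable), Prop. 5.1.1 (subspaces), Prop. 5.2.1 (products).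
* I. M. Gel'fand, N. Ya. Vilenkin, *Generalized Functions IV* (1964), Ch. I §3 (countably-Hilbert
  nuclear spaces; the consumer of these facts is Minlos' theorem, Ch. IV).

## Mathlib

Used: `Seminorm.bound_of_continuous`, `WithSeminorms.mem_nhds_iff`,
`WithSeminorms.continuous_seminorm`, `summable_extend_zero` / `tsum_extend_zero` (reindexing
along an injection into `ℕ`), `Summable.tsum_sum` (sums over `α ⊕ β`),
`TopologicalSpace.IsSeparable.exists_countable_dense_subset`, `Summable.sum_add_tsum_nat_add`,
`tendsto_sum_nat_add`. Nuclear spaces are absent from Mathlib at the pin.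
-/

open scoped NNReal Topology
open Filter TopologicalSpace Set Function

namespace Literature.Analysis.FunctionSpaces

variable {𝕜 : Type*} [RCLike 𝕜] {E : Type*} [AddCommGroup E] [Module 𝕜 E] [TopologicalSpace E]
  {F : Type*} [AddCommGroup F] [Module 𝕜 F] [TopologicalSpace F]

/-- A seminorm `p` on a topological vector space is *nuclearly dominated* if there are a
continuous seminorm `q`, continuous linear functionals `φₙ` and a summable sequence `cₙ ≥ 0` with
`‖φₙ x‖ ≤ cₙ q x` and `p x ≤ ∑ₙ ‖φₙ x‖` for all `x` — i.e. `p` is dominated by the nuclear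
seminorm `∑ₙ |φₙ|`. `Literature.NuclearSpace 𝕜 E` says precisely that every continuous seminorm is
nuclearly dominated. Pietsch 1972, Prop. 4.1.4. [cite: Pietsch1972, Prop. 4.1.4] -/
def IsNuclearlyDominated (p : Seminorm 𝕜 E) : Prop :=
  ∃ q : Seminorm 𝕜 E, Continuous q ∧ ∃ (φ : ℕ → E →L[𝕜] 𝕜) (c : ℕ → ℝ≥0),
    Summable c ∧ (∀ n x, ‖φ n x‖ ≤ c n * q x) ∧ ∀ x, p x ≤ ∑' n, ‖φ n x‖

/-- By definition, `E` is nuclear iff every continuous seminorm is nuclearly dominated.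
Pietsch 1972, Prop. 4.1.4. [cite: Pietsch1972, Prop. 4.1.4] -/
theorem nuclearSpace_iff_isNuclearlyDominated :
    NuclearSpace 𝕜 E ↔ ∀ p : Seminorm 𝕜 E, Continuous p → IsNuclearlyDominated p :=
  ⟨fun h => h.exists_nuclear_dominating, fun h => ⟨h⟩⟩

/-- In a nuclear space every continuous seminorm is nuclearly dominated (the axiom of
`NuclearSpace`). Pietsch 1972, Prop. 4.1.4. [cite: Pietsch1972, Prop. 4.1.4] -/
theorem NuclearSpace.isNuclearlyDominated [NuclearSpace 𝕜 E] (p : Seminorm 𝕜 E)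
    (hp : Continuous p) : IsNuclearlyDominated p :=
  NuclearSpace.exists_nuclear_dominating p hp

namespace IsNuclearlyDominated

/-- The domination `‖φₐ x‖ ≤ cₐ q x`, `∑ cₐ < ∞`, makes `∑ₐ ‖φₐ x‖` summable. [folklore] -/
theorem summable_norm_apply {q : Seminorm 𝕜 E} {α : Type*} {φ : α → E →L[𝕜] 𝕜} {c : α → ℝ≥0}
    (hc : Summable c) (hφ : ∀ a x, ‖φ a x‖ ≤ c a * q x) (x : E) :
    Summable fun a => ‖φ a x‖ :=
  Summable.of_nonneg_of_le (fun _ => norm_nonneg _) (fun a => hφ a x)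
    ((NNReal.summable_coe.2 hc).mul_right (q x))

/-- `∑ₐ ‖φₐ x‖ ≤ (∑ₐ cₐ) q x` under the domination `‖φₐ x‖ ≤ cₐ q x`. [folklore] -/
theorem tsum_norm_apply_le {q : Seminorm 𝕜 E} {α : Type*} {φ : α → E →L[𝕜] 𝕜} {c : α → ℝ≥0}
    (hc : Summable c) (hφ : ∀ a x, ‖φ a x‖ ≤ c a * q x) (x : E) :
    ∑' a, ‖φ a x‖ ≤ (∑' a, (c a : ℝ)) * q x := by
  rw [← tsum_mul_right]
  exact (summable_norm_apply hc hφ x).tsum_le_tsum (fun a => hφ a x)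
    ((NNReal.summable_coe.2 hc).mul_right _)

/-- **Reindexing.** A domination by a nuclear seminorm indexed by an arbitrary countable set
gives one indexed by `ℕ` (extend by zero along an injection into `ℕ`). [folklore] -/
theorem of_countable {α : Type*} [Countable α] {p q : Seminorm 𝕜 E} (hq : Continuous q)
    (φ : α → E →L[𝕜] 𝕜) (c : α → ℝ≥0) (hc : Summable c) (hφ : ∀ a x, ‖φ a x‖ ≤ c a * q x)
    (hp : ∀ x, p x ≤ ∑' a, ‖φ a x‖) : IsNuclearlyDominated p := by
  classical
  obtain ⟨e, he⟩ := Countable.exists_injective_nat α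
  refine ⟨q, hq, extend e φ 0, extend e c 0, (summable_extend_zero he).2 hc, fun n x => ?_,
    fun x => ?_⟩
  · by_cases hn : ∃ a, e a = n
    · obtain ⟨a, rfl⟩ := hn
      rw [he.extend_apply, he.extend_apply]
      exact hφ a x
    · rw [extend_apply' _ _ _ hn, extend_apply' _ _ _ hn]
      simp
  · have h : (fun n => ‖(extend e φ 0 n) x‖) = extend e (fun a => ‖φ a x‖) 0 := by
      funext n
      rw [apply_extend (fun ψ : E →L[𝕜] 𝕜 => ‖ψ x‖) e 0 n]
      congr 1
      funext m
      simp
    rw [h, tsum_extend_zero he]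
    exact hp x

/-- A seminorm below a nuclearly dominated one is nuclearly dominated. [folklore] -/
theorem mono {p p' : Seminorm 𝕜 E} (h : IsNuclearlyDominated p) (hle : p' ≤ p) :
    IsNuclearlyDominated p' := by
  obtain ⟨q, hq, φ, c, hc, hφ, hp⟩ := h
  exact ⟨q, hq, φ, c, hc, hφ, fun x => (hle x).trans (hp x)⟩

/-- The zero seminorm is nuclearly dominated. [folklore] -/
theorem zero : IsNuclearlyDominated (0 : Seminorm 𝕜 E) := by
  refine ⟨0, ?_, 0, 0, summable_zero, fun n x => by simp, fun x => ?_⟩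
  · rw [FunLike.coe_zero]
    exact continuous_zero
  · simp

/-- Nonnegative multiples of nuclearly dominated seminorms are nuclearly dominated. [folklore] -/
theorem smul {p : Seminorm 𝕜 E} (h : IsNuclearlyDominated p) (C : ℝ≥0) :
    IsNuclearlyDominated (C • p) := by
  obtain ⟨q, hq, φ, c, hc, hφ, hp⟩ := h
  refine ⟨q, hq, fun n => ((C : ℝ) : 𝕜) • φ n, fun n => C * c n, hc.mul_left C, fun n x => ?_,
    fun x => ?_⟩
  · rw [smul_apply, norm_smul, RCLike.norm_ofReal, NNReal.abs_eq,
      NNReal.coe_mul, mul_assoc]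
    exact mul_le_mul_of_nonneg_left (hφ n x) C.2
  · have h1 : ∀ n, ‖(((C : ℝ) : 𝕜) • φ n) x‖ = C * ‖φ n x‖ := fun n => by
      rw [smul_apply, norm_smul, RCLike.norm_ofReal, NNReal.abs_eq]
    simp_rw [h1]
    rw [tsum_mul_left, smul_apply, NNReal.smul_def, smul_eq_mul]
    exact mul_le_mul_of_nonneg_left (hp x) C.2

/-- Sums of nuclearly dominated seminorms are nuclearly dominated (concatenate the two families
of functionals). [folklore] -/
theorem add {p₁ p₂ : Seminorm 𝕜 E} (h₁ : IsNuclearlyDominated p₁)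
    (h₂ : IsNuclearlyDominated p₂) : IsNuclearlyDominated (p₁ + p₂) := by
  obtain ⟨q₁, hq₁, φ₁, c₁, hc₁, hφ₁, hp₁⟩ := h₁
  obtain ⟨q₂, hq₂, φ₂, c₂, hc₂, hφ₂, hp₂⟩ := h₂
  refine of_countable (q := q₁ + q₂) ?_ (Sum.elim φ₁ φ₂) (Sum.elim c₁ c₂) ?_ ?_ ?_
  · rw [FunLike.coe_add]
    exact hq₁.add hq₂
  · exact Summable.sum _ (by simpa using hc₁) (by simpa using hc₂)
  · rintro (n | n) x
    · simp only [Sum.elim_inl, add_apply]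
      exact (hφ₁ n x).trans (mul_le_mul_of_nonneg_left (le_add_of_nonneg_right (apply_nonneg _ _))
        (c₁ n).2)
    · simp only [Sum.elim_inr, add_apply]
      exact (hφ₂ n x).trans (mul_le_mul_of_nonneg_left (le_add_of_nonneg_left (apply_nonneg _ _))
        (c₂ n).2)
  · intro x
    rw [Summable.tsum_sum (f := fun i => ‖Sum.elim φ₁ φ₂ i x‖)
      (summable_norm_apply hc₁ hφ₁ x) (summable_norm_apply hc₂ hφ₂ x), add_apply]
    exact add_le_add (hp₁ x) (hp₂ x)

/-- Finite sums of nuclearly dominated seminorms are nuclearly dominated. [folklore] -/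
theorem finset_sum {ι : Type*} {p : ι → Seminorm 𝕜 E} (s : Finset ι)
    (h : ∀ i ∈ s, IsNuclearlyDominated (p i)) : IsNuclearlyDominated (∑ i ∈ s, p i) := by
  classical
  induction s using Finset.induction_on with
  | empty => simpa using zero
  | insert i s hi ih =>
    rw [Finset.sum_insert hi]
    exact (h i (Finset.mem_insert_self i s)).add (ih fun j hj => h j (Finset.mem_insert_of_mem hj))

/-- Finite suprema of nuclearly dominated seminorms are nuclearly dominated. [folklore] -/
theorem finset_sup {ι : Type*} {p : ι → Seminorm 𝕜 E} (s : Finset ι)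
    (h : ∀ i ∈ s, IsNuclearlyDominated (p i)) : IsNuclearlyDominated (s.sup p) :=
  (finset_sum s h).mono (Seminorm.finset_sup_le_sum p s)

/-- Pull-back: if `p` is nuclearly dominated on `F` and `T : E →L F`, then `p ∘ T` is nuclearly
dominated on `E`. Pietsch 1972, §5.1. [cite: Pietsch1972, §5.1] -/
theorem comp {p : Seminorm 𝕜 F} (h : IsNuclearlyDominated p) (T : E →L[𝕜] F) :
    IsNuclearlyDominated (p.comp T.toLinearMap) := by
  obtain ⟨q, hq, φ, c, hc, hφ, hp⟩ := h
  exact ⟨q.comp T.toLinearMap, hq.comp T.continuous, fun n => (φ n).comp T, c, hc,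
    fun n x => hφ n (T x), fun x => hp (T x)⟩

/-- **Nuclearity from a generating family.** If the topology of `E` is induced by a family of
seminorms each of which is nuclearly dominated, then `E` is nuclear: a continuous seminorm is
bounded by `C • s.sup q` (`Seminorm.bound_of_continuous`). Pietsch 1972, Prop. 4.1.4 /
§4.1.5. [cite: Pietsch1972, Prop. 4.1.4] -/
theorem nuclearSpace_of_withSeminorms {ι : Type*} {q : SeminormFamily 𝕜 E ι}
    (hq : WithSeminorms q) (h : ∀ i, IsNuclearlyDominated (q i)) : NuclearSpace 𝕜 E := by
  refine ⟨fun p hp => ?_⟩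
  obtain ⟨s, C, -, hle⟩ := Seminorm.bound_of_continuous hq p hp
  exact ((finset_sup s fun i _ => h i).smul C).mono hle

end IsNuclearlyDominated

/-- **Retracts of nuclear spaces are nuclear**, in the following finite form: if `F` is nuclear
and `x = ∑ᵢ Sᵢ (Tᵢ x)` for finitely many continuous linear maps `Tᵢ : E → F`, `Sᵢ : F → E`, then
`E` is nuclear (`p x ≤ ∑ᵢ (p ∘ Sᵢ) (Tᵢ x)` and each `p ∘ Sᵢ` is a continuous seminorm on `F`).
Covers subspaces with a continuous projection, finite powers and isomorphic images.
Pietsch 1972, Props. 5.1.1, 5.2.1. [cite: Pietsch1972, Prop. 5.1.1] -/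
theorem NuclearSpace.of_finite_retracts {ι : Type*} [Fintype ι] [NuclearSpace 𝕜 F]
    (T : ι → E →L[𝕜] F) (S : ι → F →L[𝕜] E) (h : ∀ x, ∑ i, S i (T i x) = x) :
    NuclearSpace 𝕜 E := by
  refine ⟨fun p hp => ?_⟩
  have hi : ∀ i, IsNuclearlyDominated ((p.comp (S i).toLinearMap).comp (T i).toLinearMap) :=
    fun i => (NuclearSpace.isNuclearlyDominated (p.comp (S i).toLinearMap)
      (by rw [Seminorm.coe_comp]; exact hp.comp (S i).continuous)).comp (T i)
  refine (IsNuclearlyDominated.finset_sum Finset.univ fun i _ => hi i).mono fun x => ?_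
  have hsum : (∑ i, (p.comp (S i).toLinearMap).comp (T i).toLinearMap) x =
      ∑ i, ((p.comp (S i).toLinearMap).comp (T i).toLinearMap) x := by
    change FunLike.coeAddMonoidHom _ _ _ (∑ i, (p.comp (S i).toLinearMap).comp (T i).toLinearMap) x = _
    rw [map_sum, Finset.sum_apply]
    rfl
  calc p x = p (∑ i, S i (T i x)) := by rw [h]
    _ ≤ ∑ i, p (S i (T i x)) :=
        Finset.le_sum_of_subadditive p (map_zero p).le (fun a b => map_add_le_add p a b) _ _
    _ = (∑ i, (p.comp (S i).toLinearMap).comp (T i).toLinearMap) x := by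
        rw [hsum]
        rfl

/-- A retract of a nuclear space is nuclear: if `S ∘ T = id` with `T : E →L F`, `S : F →L E`
and `F` nuclear then `E` is nuclear. Pietsch 1972, Prop. 5.1.1. [cite: Pietsch1972, Prop. 5.1.1] -/
theorem NuclearSpace.of_retract [NuclearSpace 𝕜 F] (T : E →L[𝕜] F) (S : F →L[𝕜] E)
    (h : ∀ x, S (T x) = x) : NuclearSpace 𝕜 E :=
  NuclearSpace.of_finite_retracts (ι := Unit) (fun _ => T) (fun _ => S) (by simpa using h)

/-- Nuclearity is invariant under topological linear isomorphisms. Pietsch 1972, §5.1.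
[cite: Pietsch1972, §5.1] -/
theorem NuclearSpace.of_continuousLinearEquiv [NuclearSpace 𝕜 F] (e : E ≃L[𝕜] F) :
    NuclearSpace 𝕜 E :=
  NuclearSpace.of_retract (e : E →L[𝕜] F) (e.symm : F →L[𝕜] E) e.symm_apply_apply

namespace IsNuclearlyDominated

/-- **A nuclearly dominated seminorm is separable**: there is a countable set `S ⊆ E` such that
every `x` is a `p`-limit of points of `S`. (If `p ≤ ∑ₙ |φₙ|`, `|φₙ| ≤ cₙ q`, truncate the series at
`M` with `∑_{n ≥ M} cₙ` small and use separability of subsets of `𝕜^M`.) Pietsch 1972,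
Prop. 4.4.9 (every normed space `E(U)` of a nuclear space is separable). [cite: Pietsch1972, Prop. 4.4.9] -/
theorem exists_countable_dense {p : Seminorm 𝕜 E} (h : IsNuclearlyDominated p) :
    ∃ S : Set E, S.Countable ∧ ∀ x : E, ∀ ε : ℝ, 0 < ε → ∃ s ∈ S, p (x - s) < ε := by
  obtain ⟨q, -, φ, c, hc, hφ, hp⟩ := h
  -- Step 1: for each truncation level `M` and each bound `k` on `q`, a countable set
  have key : ∀ M k : ℕ, ∃ S : Set E, S.Countable ∧ S ⊆ {x | q x ≤ k} ∧
      ∀ x, q x ≤ k → ∀ δ : ℝ, 0 < δ → ∃ s ∈ S, ∀ i : Fin M, ‖φ i x - φ i s‖ < δ := by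
    intro M k
    set A : Set E := {x | q x ≤ k} with hA
    set T : E → (Fin M → 𝕜) := fun x i => φ i x with hT
    have hsep : IsSeparable (T '' A) := (isSeparable_univ_iff.2 inferInstance).mono (subset_univ _)
    obtain ⟨t, htA, htc, hcl⟩ := hsep.exists_countable_dense_subset
    have hpre : ∀ b : t, ∃ x ∈ A, T x = b := fun b => htA b.2
    choose g hgA hgT using hpre
    haveI : Countable t := htc.to_subtype
    refine ⟨Set.range g, countable_range g, ?_, fun x hx δ hδ => ?_⟩
    · rintro _ ⟨b, rfl⟩
      exact hgA b
    · have hxcl : T x ∈ closure t := hcl ⟨x, hx, rfl⟩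
      obtain ⟨b, hbt, hb⟩ := Metric.mem_closure_iff.1 hxcl δ hδ
      refine ⟨g ⟨b, hbt⟩, ⟨⟨b, hbt⟩, rfl⟩, fun i => ?_⟩
      have h1 : ‖T x - b‖ < δ := by rwa [← dist_eq_norm]
      have h2 : T (g ⟨b, hbt⟩) = b := hgT ⟨b, hbt⟩
      rw [← h2] at h1
      exact (norm_le_pi_norm (T x - T (g ⟨b, hbt⟩)) i).trans_lt h1
  choose S hSc hSA hS using key
  refine ⟨⋃ M, ⋃ k, S M k, countable_iUnion fun M => countable_iUnion fun k => hSc M k,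
    fun x ε hε => ?_⟩
  -- Step 2: choose `k ≥ q x` and a truncation level `M` with small tail
  obtain ⟨k, hk⟩ := exists_nat_ge (q x)
  have htail : Tendsto (fun M : ℕ => (∑' n, (c (n + M) : ℝ)) * (2 * k + 1)) atTop (𝓝 0) := by
    have := (tendsto_sum_nat_add fun n => (c n : ℝ)).mul_const (2 * (k : ℝ) + 1)
    rwa [zero_mul] at this
  obtain ⟨M, hM⟩ := (htail.eventually (gt_mem_nhds (half_pos hε))).exists
  set δ : ℝ := ε / (2 * (M + 1)) with hδ
  have hδpos : 0 < δ := by positivity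
  obtain ⟨s, hs, hclose⟩ := hS M k x hk δ hδpos
  refine ⟨s, mem_iUnion.2 ⟨M, mem_iUnion.2 ⟨k, hs⟩⟩, ?_⟩
  have hqs : q s ≤ k := hSA M k hs
  -- Step 3: estimate `p (x - s)` by head + tail of the dominating series
  have hsum : Summable fun n => ‖φ n (x - s)‖ := summable_norm_apply hc hφ _
  have hhead : ∑ n ∈ Finset.range M, ‖φ n (x - s)‖ ≤ M * δ := by
    have : ∀ n ∈ Finset.range M, ‖φ n (x - s)‖ ≤ δ := fun n hn => by
      rw [map_sub]
      exact (hclose ⟨n, Finset.mem_range.1 hn⟩).le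
    calc ∑ n ∈ Finset.range M, ‖φ n (x - s)‖ ≤ ∑ _n ∈ Finset.range M, δ := Finset.sum_le_sum this
      _ = M * δ := by rw [Finset.sum_const, Finset.card_range, nsmul_eq_mul]
  have hhead' : (M : ℝ) * δ < ε / 2 := by
    rw [hδ, mul_div_assoc', div_lt_div_iff₀ (by positivity) (by positivity)]
    nlinarith
  have hc' : Summable fun n => c (n + M) := (NNReal.summable_nat_add_iff M).2 hc
  have htl : ∑' n, ‖φ (n + M) (x - s)‖ ≤ (∑' n, (c (n + M) : ℝ)) * q (x - s) :=
    tsum_norm_apply_le (φ := fun n => φ (n + M)) hc' (fun n y => hφ (n + M) y) (x - s)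
  have hqxs : q (x - s) ≤ 2 * k + 1 := by
    calc q (x - s) ≤ q x + q s := by
          rw [sub_eq_add_neg]
          exact (map_add_le_add q x (-s)).trans (by rw [map_neg_eq_map])
      _ ≤ k + k := add_le_add hk hqs
      _ ≤ 2 * k + 1 := by linarith
  have htl' : ∑' n, ‖φ (n + M) (x - s)‖ < ε / 2 :=
    (htl.trans (mul_le_mul_of_nonneg_left hqxs (tsum_nonneg fun n => (c (n + M)).2))).trans_lt hM
  calc p (x - s) ≤ ∑' n, ‖φ n (x - s)‖ := hp _
    _ = ∑ n ∈ Finset.range M, ‖φ n (x - s)‖ + ∑' n, ‖φ (n + M) (x - s)‖ :=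
        (hsum.sum_add_tsum_nat_add M).symm
    _ < ε / 2 + ε / 2 := add_lt_add (hhead.trans_lt hhead') htl'
    _ = ε := add_halves ε

/-- **Nuclear spaces with countably generated topology are separable.** If `E` is nuclear and
its topology is induced by a countable family of seminorms (e.g. `E` nuclear and metrisable), then
`E` is separable: the finite suprema of the family are nuclearly dominated, hence separable
(`exists_countable_dense`), and the union of the corresponding countable sets is dense.
Pietsch 1972, Thm. 4.4.10 (all nuclear metric locally convex spaces are separable). [cite: Pietsch1972, Thm. 4.4.10] -/
theorem _root_.Literature.Analysis.FunctionSpaces.NuclearSpace.separableSpace_of_withSeminorms {ι : Type*} [Countable ι]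
    {q : SeminormFamily 𝕜 E ι} (hq : WithSeminorms q) [NuclearSpace 𝕜 E] :
    SeparableSpace E := by
  classical
  haveI := hq.topologicalAddGroup
  have hS : ∀ s : Finset ι, ∃ S : Set E, S.Countable ∧
      ∀ x : E, ∀ ε : ℝ, 0 < ε → ∃ y ∈ S, (s.sup q) (x - y) < ε := fun s =>
    (NuclearSpace.isNuclearlyDominated _
      (Seminorm.continuous_finsetSup fun i _ => hq.continuous_seminorm i)).exists_countable_dense
  choose S hSc hS using hS
  refine ⟨⟨⋃ s, S s, countable_iUnion fun s => hSc s, fun x => ?_⟩⟩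
  rw [mem_closure_iff_nhds]
  intro U hU
  obtain ⟨s, r, hr, hsub⟩ := (hq.mem_nhds_iff x U).1 hU
  obtain ⟨y, hy, hyx⟩ := hS s x r hr
  refine ⟨y, hsub ?_, mem_iUnion.2 ⟨s, hy⟩⟩
  rw [Seminorm.mem_ball, map_sub_rev]
  exact hyx

end IsNuclearlyDominated

end Literature.Analysis.FunctionSpaces
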